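import Summits.QuantumFields.BalabanUV.T4Continuum.Support.GaugeTermScalarData

/-!
# T⁴ programme, spine node NE2 (U1a), tier B row B4.b — THE INSTANCE: `LayerLaws` of a transported family from the scalar tower's
# laws, and `PerturbationLaws` for the gauge term of Bałaban's typed `Δ_a(U)` from rows B4.c ∕ B4.d ∕ B4.e ∕ B4.f BY NAME

ROUND-2 swarm `t4-ne2-formalise-*`, leaf prover 05, row **B4.b**, wiring file 2 of 2 (file 1: `GaugeTermScalarData` — the data
`QuT T = B·siteMul T`, `Q1 = B`, `J0 = JK0T ⊗ 1` and the exact identifications).  With the scalar tower's two law bundles in the TREE's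
shapes —
  `hfreeS : FreeTowerLaws (k ↦ DeltaPs n_k M a′ ⊗ₖ 1) A J0 F r e₀ e₁ f`   (row B4.d, `U = 1`; lifted by `KroneckerLift.freeTowerLaws_kron`),
  `hpertS : PerturbationLaws (k ↦ DeltaPs n_k M a′ ⊗ₖ 1) (k ↦ scalarPert n_k M a′ (R k) (T k)) J0 κs e₂`, `κs < 1`   (row B4.e) —
and the transporter numbers (size `α`, lattice-Lipschitz `β/n_k`, two-level consistency `β′/n_k` of the connection `n_k(R − 1)` = the B6 /
NE3 currency; size `τ` and two-level consistency `δT k` of the site transporters `T`), **`layerLaws_of_scalarLaws`** produces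
`GaugeTermLayer.LayerLaws L M a ha R (QuT T) a′ J0 g (1 + τ) (dα) es ec θ δT` with
  `g ≥ γ′⁻¹(1 − κs)⁻¹` (`BackgroundResolventLaw.opNorm_inv_add_smul_le`), `es k = (e₁ k + e₂ k)(1 − κs)⁻²` (`perturbed_injected_law`,
  `t = 1`, through `Sop_eq_add_scalarPert`), `ec k = (1 − κs)⁻¹·e₀ k` (`opNorm_inv_add_smul_mul_le`), `θ k = ec k·d(L+1)Cst +
  g·d(β′ + 2(α+β))Cst/n_k` (leaf-10's `CovariantDivergencePlantingTower.planting_number_le`), pairing `δT k` (`Bs_succ_mul_J0`,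
  `J0_mul_siteMul`).
The FREE family `(1, 1)` is the same theorem with `scalarPert 1 1 = 0` (`scalarPert_one`, `PerturbationAlgebra.perturbationLaws_zero`); the
END of the row on Bałaban's data then is `GaugeTermPerturbationLaw.perturbationLaws_gaugeTerm` with `GaugeTermScalarData.unitDatum_one`
(`n₁ = σ₀⁻²`, row B4.c) — CONDITIONAL (displayed binders) on the scalar tower's `FreeTowerLaws` (row B4.d's END) and `PerturbationLaws`
(row B4.e's END) and on the transporter numbers (rows B5 ∕ B6 = NE3 by name ∕ B3.b-conc).

HONEST FRAMING (T4-DAG p. 1).  Bookkeeping OURS; `R`, `T`, `a′` DATA; the two scalar law bundles are HYPOTHESES in the tree's shapes (their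
instances are other rows' theorems; nothing printed is a hypothesis; no `def … : Prop`); model level, no assertion of the dictionary B0 (c5);
GLOBAL small field (`κs < 1` displayed); finite torus, linear layer, operator norm; NOT [B9] (3.23)–(3.26) as printed; NE2 NOT proved; NOT
infinite volume, NOT a mass gap, NOT Clay, NOT summit progress; spine 0/9 unchanged.  HONEST DEPENDENCY: continuum YM on T⁴ ⇐ BetaPertH ∧
nine spine estimates (0/9 proved); BetaPertH ⇐ (D1) ∧ (D4) ∧ CAP+tail; G-an2-4 gates asym, D1 and NE2/3/4.  ABSOLUTE RULE kept; no `sorry`.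
-/

noncomputable section

open scoped BigOperators ComplexConjugate Matrix Matrix.Norms.L2Operator Kronecker ComplexOrder

namespace Summit.QuantumFields.BalabanUV.T4Continuum.GaugeTermInstance

open Literature.MathematicalPhysics.QuantumFieldTheory.Balaban1983to89.B5Prop11Plancherel
open Literature.MathematicalPhysics.QuantumFieldTheory.Balaban1983to89.B5G183RateUnitTower (lev lev_neZero)
open Summit.QuantumFields.BalabanUV.T4Continuum
open Summit.QuantumFields.BalabanUV.T4Continuum.BalabanAveragedTowerUnit (idx one_le_lev' cast_lev')
open Summit.QuantumFields.BalabanUV.T4Continuum.BackgroundResolventTower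
open Summit.QuantumFields.BalabanUV.T4Continuum.BackgroundResolventLaw
open Summit.QuantumFields.BalabanUV.T4Continuum.KingPairingPlantedLaw
open Summit.QuantumFields.BalabanUV.T4Continuum.KroneckerLift
open Summit.QuantumFields.BalabanUV.T4Continuum.BlockMultiplication
open Summit.QuantumFields.BalabanUV.T4Continuum.BalabanAveragedTowerModes (par)
open Summit.QuantumFields.BalabanUV.T4Continuum.PerturbationAlgebra (perturbationLaws_mono perturbationLaws_zero)
open Summit.QuantumFields.BalabanUV.T4Continuum.GaugeTermDecomposition (covGrad defect connL opNorm_defect_le)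
open Summit.QuantumFields.BalabanUV.T4Continuum.GaugeTermSandwichLaw
open Summit.QuantumFields.BalabanUV.T4Continuum.GaugeTermLayer
open Summit.QuantumFields.BalabanUV.T4Continuum.GaugeTermPerturbationLaw
open Summit.QuantumFields.BalabanUV.T4Continuum.GaugeTermScalarData
open Summit.QuantumFields.BalabanUV.T4Continuum.ScalarAveragedPropagator (DeltaPs Gps gammaPs gammaPs_pos isUnit_det_DeltaPs opNorm_Gps_le)
open Summit.QuantumFields.BalabanUV.T4Continuum.ScalarAveragedCompression (sigma0)
open Summit.QuantumFields.BalabanUV.T4Continuum.ScalarCovariantLaplacian (Bs scalarPert scalarPert_one opNorm_Bs_le)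
open Summit.QuantumFields.BalabanUV.T4Continuum.BlockPairingGeometry (tau parT)
open Summit.QuantumFields.BalabanUV.T4Continuum.CovariantDivergencePlantingTower (JK0T Pi0T Pi0T_eq planting_number_le)

variable {d : ℕ} (L : ℕ) [NeZero L] (M : Fin d → ℕ) [hM : ∀ μ, NeZero (M μ)] (a : ℝ) (ha : 0 < a)
variable {o : Type*} [Fintype o] [DecidableEq o]

/-! ## §1 Numbers and small lemmas -/

/-- the scalar injected number `(e₁ k + e₂ k)(1 − κs)⁻²`. [folklore] -/
def esS (κs : ℝ) (e₁ e₂ : ℕ → ℝ) (k : ℕ) : ℝ := (e₁ k + e₂ k) * ((1 - κs)⁻¹) ^ 2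

/-- the scalar complement number `(1 − κs)⁻¹·e₀ k`. [folklore] -/
def ecS (κs : ℝ) (e₀ : ℕ → ℝ) (k : ℕ) : ℝ := (1 - κs)⁻¹ * e₀ k

/-- the planting number `θ k = ec k·d(L+1)Cst + g·d(β′ + 2(α+β))Cst/n_k` (leaf-10's `planting_number_le`). [folklore] -/
def thetaS (d L : ℕ) (a g α β β' : ℝ) (ec : ℕ → ℝ) (k : ℕ) : ℝ :=
  ec k * (d * ((L : ℝ) + 1) * Cst d a) + g * (d * ((β' + 2 * (α + β)) * Cst d a / (lev L k : ℕ)))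

/-- `‖(Δ′_k ⊗ 1)⁻¹‖ ≤ γ′⁻¹`. [folklore] -/
theorem opNorm_inv_DeltaPs_kron_le {a' : ℝ} (ha' : 0 < a') (k : ℕ) :
    ‖(DeltaPs (lev L k) M a' ⊗ₖ (1 : Matrix o o ℂ))⁻¹‖ ≤ (gammaPs d a')⁻¹ := by
  rw [kron_inv]; exact opNorm_kron_le_of_le o (opNorm_Gps_le (lev L k) M ha')

/-- `(1 − Π₀) ⊗ 1 = 1 − J0·J0ᴴ`. [folklore] -/
theorem one_sub_Pi0T_kron (k : ℕ) :
    (1 - Pi0T L M k) ⊗ₖ (1 : Matrix o o ℂ) = 1 - J0 L M o k * (J0 L M o k)ᴴ := by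
  rw [sub_kronecker, Matrix.one_kronecker_one, Pi0T_eq, kron_mul, ← kron_conjTranspose]; rfl

/-! ## §2 `LayerLaws` of a transported family from the scalar tower's laws -/

variable (R : (k : ℕ) → Fin d → (Tor (fine (lev L k) M) → Matrix o o ℂ)) (T : (k : ℕ) → Tor (fine (lev L k) M) → Matrix o o ℂ) (a' : ℝ)

/-- **`LayerLaws` FROM THE SCALAR TOWER's LAWS.**  See the module docstring for the constants. [folklore] -/
theorem layerLaws_of_scalarLaws (ha' : 0 < a') (hd : 1 ≤ d)
    {A : (k : ℕ) → Matrix (Tor (fine (lev L k) M) × o) (Tor (fine (lev L (k + 1)) M) × o) ℂ}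
    {F : (k : ℕ) → Matrix (Tor (fine (lev L k) M) × o) (Tor (fine (lev L k) M) × o) ℂ} {r : ℝ} {e₀ e₁ f e₂ δT : ℕ → ℝ}
    {κs g α β β' τ : ℝ}
    (hfreeS : FreeTowerLaws (fun k => DeltaPs (lev L k) M a' ⊗ₖ (1 : Matrix o o ℂ)) A (J0 L M o) F r e₀ e₁ f)
    (hpertS : PerturbationLaws (fun k => DeltaPs (lev L k) M a' ⊗ₖ (1 : Matrix o o ℂ))
      (fun k => scalarPert (lev L k) M a' (R k) (T k)) (J0 L M o) κs e₂)
    (hκ : κs < 1) (hg : (gammaPs d a')⁻¹ * (1 - κs)⁻¹ ≤ g) (hα : 0 ≤ α) (hβ : 0 ≤ β) (hβ' : 0 ≤ β') (hτ : 0 ≤ τ)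
    (hR : ∀ k μ i, ‖connL (fine (lev L k) M) (cl L k) (R k) μ i‖ ≤ α)
    (hLip : ∀ k μ lam i, ‖connL (fine (lev L k) M) (cl L k) (R k) μ (tau (fine (lev L k) M) lam i)
      - connL (fine (lev L k) M) (cl L k) (R k) μ i‖ ≤ β / (lev L k : ℕ))
    (hcons : ∀ k μ (i' : Tor (fine (lev L (k + 1)) M) × Fin d),
      ‖connL (fine (lev L (k + 1)) M) (cl L (k + 1)) (R (k + 1)) μ i' - connL (fine (lev L k) M) (cl L k) (R k) μ (parT (lev L k) L M i')‖
        ≤ β' / (lev L k : ℕ))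
    (hT : ∀ k, ‖siteMul (T k) - 1‖ ≤ τ)
    (hTc : ∀ k, ‖siteMul (T (k + 1)) - siteMul (fun x' : Tor (fine (lev L (k + 1)) M) => T k (par (lev L k) L M x'))‖ ≤ δT k) :
    LayerLaws L M a ha R (QuT L M o T) a' (J0 L M o) g (1 + τ) (d * α) (esS κs e₁ e₂) (ecS κs e₀) (thetaS d L a g α β β' (ecS κs e₀)) δT := by
  have hκ0 : 0 ≤ κs := (norm_nonneg _).trans (hpertS.opNorm_P_mul_inv_le 0)
  have ht : ‖(1 : ℂ)‖ * κs < 1 := by rw [norm_one, one_mul]; exact hκ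
  have hν : 0 ≤ (1 - κs)⁻¹ := inv_nonneg.mpr (by linarith)
  have hγ : 0 ≤ (gammaPs d a')⁻¹ := inv_nonneg.mpr (gammaPs_pos (d := d) (a' := a')).1.le
  have hgn : 0 ≤ g := (mul_nonneg hγ hν).trans hg
  have hD : ∀ k, IsUnit (DeltaPs (lev L k) M a' ⊗ₖ (1 : Matrix o o ℂ)).det := hfreeS.isUnit_det
  -- the family's resolvent is the perturbed free one
  have hG : ∀ k, Gop L M R (QuT L M o T) a' k
      = (DeltaPs (lev L k) M a' ⊗ₖ (1 : Matrix o o ℂ) + (1 : ℂ) • scalarPert (lev L k) M a' (R k) (T k))⁻¹ := fun k => by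
    rw [Gop, Sop_eq_add_scalarPert]
  have hGle : ∀ k, ‖Gop L M R (QuT L M o T) a' k‖ ≤ g := fun k => by
    rw [hG]
    refine (opNorm_inv_add_smul_le (hD k) (hpertS.opNorm_P_mul_inv_le k) ht).trans ?_
    rw [norm_one, one_mul]
    exact (mul_le_mul_of_nonneg_right (opNorm_inv_DeltaPs_kron_le L M ha' k) hν).trans hg
  have hBs : ∀ (n : ℕ) [NeZero n], ‖Bs o n M‖ ≤ 1 := fun n _ => opNorm_Bs_le o n M
  have hSite : ∀ k, ‖siteMul (T k)‖ ≤ 1 + τ := fun k => by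
    have e : siteMul (T k) = 1 + (siteMul (T k) - 1) := by abel
    rw [e]; exact (norm_add_le _ _).trans (add_le_add l2_opNorm_one_le (hT k))
  have hcompl : ∀ k, ‖Gop L M R (QuT L M o T) a' (k + 1) * (1 - J0 L M o k * (J0 L M o k)ᴴ)‖ ≤ ecS κs e₀ k := fun k => by
    have e : Gop L M R (QuT L M o T) a' (k + 1) * (1 - J0 L M o k * (J0 L M o k)ᴴ)
        = (Gop L M R (QuT L M o T) a' (k + 1) * (DeltaPs (lev L (k + 1)) M a' ⊗ₖ (1 : Matrix o o ℂ)))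
          * ((DeltaPs (lev L (k + 1)) M a' ⊗ₖ (1 : Matrix o o ℂ))⁻¹ * (1 - J0 L M o k * (J0 L M o k)ᴴ)) := by
      rw [Matrix.mul_assoc, ← Matrix.mul_assoc (DeltaPs _ M a' ⊗ₖ _), Matrix.mul_nonsing_inv _ (hD (k + 1)), Matrix.one_mul]
    rw [e, ecS]
    refine (Matrix.l2_opNorm_mul _ _).trans (mul_le_mul ?_ (hfreeS.complement_le k) (norm_nonneg _) hν)
    rw [hG]
    have h := opNorm_inv_add_smul_mul_le (hD (k + 1)) (hpertS.opNorm_inv_mul_P_le (k + 1)) ht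
    rwa [norm_one, one_mul] at h
  refine
    { nonneg := ⟨ha'.le, by linarith, mul_nonneg (Nat.cast_nonneg d) hα⟩
      isUnit_S := fun k => ?_
      opNorm_G_le := hGle
      opNorm_Q_le := fun k => ?_
      opNorm_defect_le := fun k => opNorm_defect_le (fine (lev L k) M) (cl L k) hα (hR k)
      injected_le := fun k => ?_
      complement_le := hcompl
      planting_le := fun k => ?_
      pairing_le := fun k => ?_ }
  · -- invertibility of `S_k = D_k + 1•P_k`
    rw [Sop_eq_add_scalarPert]
    exact isUnit_det_add_smul_right (hD k) (hpertS.opNorm_P_mul_inv_le k) ht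
  · -- `‖B·siteMul T‖ ≤ 1 + τ`
    rw [QuT]
    exact (Matrix.l2_opNorm_mul _ _).trans ((mul_le_mul (hBs (lev L k)) (hSite k) (norm_nonneg _) zero_le_one).trans (by rw [one_mul]))
  · -- the perturbed injected law on the scalar tower
    rw [hG, hG, esS]
    have h := perturbed_injected_law (J := J0 L M o k) (hD k) (hD (k + 1)) (hpertS.opNorm_P_mul_inv_le k)
      (hpertS.opNorm_inv_mul_P_le (k + 1)) ht (hfreeS.injected_le k) (hpertS.consistent_le k)
    rwa [norm_one, one_mul, one_mul] at h
  · -- the planting number (row B4.f)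
    have hcomp : ‖Gop L M R (QuT L M o T) a' (k + 1) * ((1 - Pi0T L M k) ⊗ₖ (1 : Matrix o o ℂ))‖ ≤ ecS κs e₀ k := by
      rw [one_sub_Pi0T_kron]; exact hcompl k
    have hec : 0 ≤ ecS κs e₀ k := (norm_nonneg _).trans (hcompl k)
    exact planting_number_le L M a ha hd R k hα hβ hβ' hgn hec (hR k) (hLip k) (hcons k) (hGle (k + 1)) hcomp
  · -- the pairing of the transported averaging with the planting
    have e : QuT L M o T (k + 1) * J0 L M o k - QuT L M o T k
        = Bs o (lev L (k + 1)) M * (siteMul (T (k + 1)) - siteMul (fun x' : Tor (fine (lev L (k + 1)) M) => T k (par (lev L k) L M x')))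
          * J0 L M o k := by
      rw [QuT, QuT, ← Bs_succ_mul_J0 L M (o := o) k, Matrix.mul_sub, Matrix.sub_mul, Matrix.mul_assoc, Matrix.mul_assoc,
        Matrix.mul_assoc, J0_mul_siteMul]
    rw [e]
    calc _ ≤ ‖Bs o (lev L (k + 1)) M * (siteMul (T (k + 1)) - siteMul (fun x' : Tor (fine (lev L (k + 1)) M) => T k (par (lev L k) L M x')))‖
            * ‖J0 L M o k‖ := Matrix.l2_opNorm_mul _ _
      _ ≤ (1 * δT k) * 1 := mul_le_mul ((Matrix.l2_opNorm_mul _ _).trans (mul_le_mul (hBs (lev L (k + 1))) (hTc k) (norm_nonneg _)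
            zero_le_one)) (hfreeS.opNorm_J_le k) (norm_nonneg _) (by have := (norm_nonneg _).trans (hTc k); positivity)
      _ = δT k := by ring

/-! ## §3 The free family and the END on Bałaban's data -/

omit [NeZero L] hM [Fintype o] in
/-- the trivial transporters have zero connection. [folklore] -/
theorem connL_oneR (k : ℕ) (μ : Fin d) (i : Tor (fine (lev L k) M) × Fin d) :
    connL (fine (lev L k) M) (cl L k) (oneR L M (o := o) k) μ i = 0 := by
  simp [connL, oneR]

/-- the free family's scalar perturbation vanishes identically. [folklore] -/
theorem scalarPert_free :
    (fun k => scalarPert (lev L k) M a' (oneR L M (o := o) k) (fun _ => (1 : Matrix o o ℂ))) = fun _ => 0 :=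
  funext fun k => scalarPert_one (lev L k) M a'

/-- hence it has `PerturbationLaws` with any `κs ≥ 0` and `e₂ = 0`. [folklore] -/
theorem perturbationLaws_free_scalar {κs : ℝ} (hκ0 : 0 ≤ κs)
    (J : (k : ℕ) → Matrix (Tor (fine (lev L (k + 1)) M) × o) (Tor (fine (lev L k) M) × o) ℂ) :
    PerturbationLaws (fun k => DeltaPs (lev L k) M a' ⊗ₖ (1 : Matrix o o ℂ))
      (fun k => scalarPert (lev L k) M a' (oneR L M (o := o) k) (fun _ => (1 : Matrix o o ℂ))) J κs (fun _ => 0) := by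
  rw [scalarPert_free]
  exact perturbationLaws_mono perturbationLaws_zero hκ0 fun _ => le_rfl

/-- `‖Q_U − Q_1‖ ≤ τ` from `‖siteMul T − 1‖ ≤ τ`. [folklore] -/
theorem opNorm_QuT_sub_Q1_le {τ : ℝ} (hT : ∀ k, ‖siteMul (T k) - 1‖ ≤ τ) (k : ℕ) : ‖QuT L M o T k - Q1 L M o k‖ ≤ τ := by
  have e : QuT L M o T k - Q1 L M o k = Bs o (lev L k) M * (siteMul (T k) - 1) := by rw [QuT, Q1, Matrix.mul_sub, Matrix.mul_one]
  rw [e]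
  exact (Matrix.l2_opNorm_mul _ _).trans ((mul_le_mul (opNorm_Bs_le o (lev L k) M) (hT k) (norm_nonneg _) zero_le_one).trans
    (by rw [one_mul]))

/-- **ROW B4.b ON BAŁABAN's DATA — `PerturbationLaws` FOR THE GAUGE TERM `D_UP(U)D_U* − (∂P∂*) ⊗ 1` of the typed `Δ_a(U)`**, from the
scalar tower's `FreeTowerLaws` (row B4.d) and `PerturbationLaws` (row B4.e) — DISPLAYED binders in the tree's shapes — the transporter
numbers (rows B5 ∕ B6 = NE3 by name ∕ B3.b-conc) and the small-field condition `σ₀⁻²·δK < 1`; the `U = 1` data `γ′`, `σ₀` are leaf-09's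
theorems (`opNorm_Gps_le`, `opNorm_Kcomp_inv_le`), the planting number leaf-10's (`planting_number_le`).  THE TARGET SHAPE of
`t4/formal/NE2/LEAVES.md` for the B4 summand; consumed by the assembly B7 (`perturbationLaws_add`).  NOT NE2; model level; statement and
constants OURS. [folklore] -/
theorem perturbationLaws_gaugeTerm_balaban (ha' : 0 < a') (hd : 1 ≤ d)
    {A : (k : ℕ) → Matrix (Tor (fine (lev L k) M) × o) (Tor (fine (lev L (k + 1)) M) × o) ℂ}
    {F : (k : ℕ) → Matrix (Tor (fine (lev L k) M) × o) (Tor (fine (lev L k) M) × o) ℂ} {r : ℝ} {e₀ e₁ f e₂ δT : ℕ → ℝ}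
    {κs α β β' τ : ℝ}
    (hfreeS : FreeTowerLaws (fun k => DeltaPs (lev L k) M a' ⊗ₖ (1 : Matrix o o ℂ)) A (J0 L M o) F r e₀ e₁ f)
    (hpertS : PerturbationLaws (fun k => DeltaPs (lev L k) M a' ⊗ₖ (1 : Matrix o o ℂ))
      (fun k => scalarPert (lev L k) M a' (R k) (T k)) (J0 L M o) κs e₂)
    (hκ : κs < 1) (hα : 0 ≤ α) (hβ : 0 ≤ β) (hβ' : 0 ≤ β') (hτ : 0 ≤ τ)
    (hR : ∀ k μ i, ‖connL (fine (lev L k) M) (cl L k) (R k) μ i‖ ≤ α)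
    (hLip : ∀ k μ lam i, ‖connL (fine (lev L k) M) (cl L k) (R k) μ (tau (fine (lev L k) M) lam i)
      - connL (fine (lev L k) M) (cl L k) (R k) μ i‖ ≤ β / (lev L k : ℕ))
    (hcons : ∀ k μ (i' : Tor (fine (lev L (k + 1)) M) × Fin d),
      ‖connL (fine (lev L (k + 1)) M) (cl L (k + 1)) (R (k + 1)) μ i' - connL (fine (lev L k) M) (cl L k) (R k) μ (parT (lev L k) L M i')‖
        ≤ β' / (lev L k : ℕ))
    (hT : ∀ k, ‖siteMul (T k) - 1‖ ≤ τ)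
    (hTc : ∀ k, ‖siteMul (T (k + 1)) - siteMul (fun x' : Tor (fine (lev L (k + 1)) M) => T k (par (lev L k) L M x'))‖ ≤ δT k)
    (hsmall : ((sigma0 d a') ^ 2)⁻¹ * deltaK ((gammaPs d a')⁻¹ * (1 - κs)⁻¹) (1 + τ) (d * α) τ a' < 1) :
    PerturbationLaws (fun k => calDalev L M a ha k ⊗ₖ (1 : Matrix o o ℂ)) (gaugeTerm L M R (QuT L M o T) (Q1 L M o) a')
      (fun k => JpcT L M k ⊗ₖ (1 : Matrix o o ℂ))
      (kappaGT d a ((gammaPs d a')⁻¹ * (1 - κs)⁻¹) (1 + τ) (d * α) τ a' (((sigma0 d a') ^ 2)⁻¹))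
      (EGT d L a ((gammaPs d a')⁻¹ * (1 - κs)⁻¹) (1 + τ) (d * α) τ a' (((sigma0 d a') ^ 2)⁻¹)
        (esS κs e₁ e₂) (ecS κs e₀) (thetaS d L a ((gammaPs d a')⁻¹ * (1 - κs)⁻¹) α β β' (ecS κs e₀)) δT
        (esS κs e₁ (fun _ => 0)) (ecS κs e₀) (thetaS d L a ((gammaPs d a')⁻¹ * (1 - κs)⁻¹) α β β' (ecS κs e₀)) δT) := by
  have hκ0 : 0 ≤ κs := (norm_nonneg _).trans (hpertS.opNorm_P_mul_inv_le 0)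
  have hδT : ∀ k, 0 ≤ δT k := fun k => (norm_nonneg _).trans (hTc k)
  -- the background family
  have hu := layerLaws_of_scalarLaws L M a ha R T a' ha' hd hfreeS hpertS hκ le_rfl hα hβ hβ' hτ hR hLip hcons hT hTc
  -- the free family: same numbers, zero connection, trivial transport
  have h₁' := layerLaws_of_scalarLaws L M a ha (oneR L M (o := o)) (fun k (_ : Tor (fine (lev L k) M)) => (1 : Matrix o o ℂ)) a' ha' hd
    hfreeS (perturbationLaws_free_scalar L M a' hκ0 (J0 L M o)) hκ le_rfl hα hβ hβ' hτ
    (fun k μ i => by rw [connL_oneR, norm_zero]; exact hα)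
    (fun k μ lam i => by
      rw [connL_oneR, connL_oneR, sub_zero, norm_zero]; exact div_nonneg hβ (Nat.cast_nonneg _))
    (fun k μ i' => by
      rw [connL_oneR, connL_oneR, sub_zero, norm_zero]; exact div_nonneg hβ' (Nat.cast_nonneg _))
    (fun k => by simp only [siteMul_one, sub_self, norm_zero]; exact hτ)
    (fun k => by simp only [siteMul_one, sub_self, norm_zero]; exact hδT k)
  rw [QuT_one] at h₁'
  exact perturbationLaws_gaugeTerm L M a ha R (QuT L M o T) (Q1 L M o) a' (J0 L M o) hu h₁' (opNorm_QuT_sub_Q1_le L M T hT)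
    (fun k => (unitDatum_one L M a' ha' k).1) (fun k => (unitDatum_one L M a' ha' k).2) hsmall

end Summit.QuantumFields.BalabanUV.T4Continuum.GaugeTermInstance

end
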